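import Summits.QuantumFields.QCD.Theorems.SpectralDefectExtinctionWindowExtinctionStubInertiaMonotone
import HarnessLib

/-!
# Strict monotonicity of the deep index under a box surgery, one-sided invertibility
# (stub `stub_inertiaMonotoneWeak`)

Stub `stub_inertiaMonotoneWeak` (S7′) of line `free-volume-heavy-witness` (reshape r4) of crux
`Summit.QuantumFields.QCD.Theses.SpectralDefectExtinction.WindowExtinction`
(item stmt-QuantumFields-8964).  It is the landed S7 `stub_inertiaMonotone`
(`…StubInertiaMonotone`) with the invertibility hypothesis on the `U'`-side box block REMOVED.

* `inertia_negRootCount_add_le_of_form_nonneg` — Weyl/Loewner monotonicity of the negative count: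
  adding a Hermitian matrix with nonnegative form cannot increase `n₋` (min–max on the negative
  test space of the sum).
* `inertia_offBlock_monotone_weak` — the abstract off-block monotonicity
  `n₋(H) + n₋(A') ≤ n₋(H') + n₋(A) + #K` of `inertia_offBlock_monotone` assuming invertibility of
  the inside block `A` of `H` ONLY.  Proof (ε-regularisation of the `H'`-side): replace `H'` by
  `H'_ε = H' + ε Π` with `Π` the diagonal projection onto the inside indices and a small `ε > 0`
  avoiding the finitely many `−λ_i(A')`; then `A'_ε = A' + ε` is invertible, `n₋(A') ≤ n₋(A'_ε)`
  (local lower semicontinuity of `n₋` along a Hermitian pencil, `negRootCount_local`),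
  `n₋(H'_ε) ≤ n₋(H')` (`ε Π ≥ 0`), and `inertia_offBlock_monotone` applies to `H, H'_ε` (the
  outside block and the off-block support are unchanged, `Π` being diagonal and inside).
* `stub_inertiaMonotoneWeak` — the Wilson–Dirac instance, verbatim as in S7.

References: Haynsworth, Linear Algebra Appl. 1 (1968) 73–81; Horn–Johnson, *Matrix Analysis*
(1985), Thm. 4.3.1 (Weyl) and Thm. 4.5.8 (Sylvester).
-/

noncomputable section

namespace Summit.QuantumFields.QCD.Cruxes.WindowExtinction.FreeVolumeHeavyWitness

open Matrix
open Summit.QuantumFields.QCD.Theorems.ExtinctionBuildsQCD.Negative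
open scoped BigOperators

section Weyl

variable {n : Type*} [Fintype n] [DecidableEq n]

/-- **Weyl monotonicity of the negative count.**  For Hermitian `X` and Hermitian `E` with
nonnegative form `Re⟨v, E v⟩ ≥ 0`, `n₋(X + E) ≤ n₋(X)`: on the negative test space of `X + E`
the form of `X = (X + E) − E` is negative. -/
theorem inertia_negRootCount_add_le_of_form_nonneg {X E : Matrix n n ℂ} (hX : X.IsHermitian)
    (hE : E.IsHermitian) (hEv : ∀ v : n → ℂ, 0 ≤ (star v ⬝ᵥ (E *ᵥ v)).re) :
    negRootCount (X + E) ≤ negRootCount X := by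
  have hXE : (X + E).IsHermitian := hX.add hE
  rw [negRootCount_eq_card hXE, negRootCount_eq_card hX, ← Fintype.card_subtype]
  have h := card_le_card_eigenvalues_of_form_pos hX (-1)
    (Matrix.mulVecLin (hXE.eigenvectorUnitary : Matrix n n ℂ) ∘ₗ
      extendByZero (fun i => hXE.eigenvalues i < 0)) (fun c hc => ?_)
  · simpa only [neg_mul, one_mul, Left.neg_pos_iff] using h
  · have h1 := inertia_negMap_form_neg hXE c hc
    have h2 := hEv ((hXE.eigenvectorUnitary : Matrix n n ℂ) *ᵥ
      extendByZero (fun i => hXE.eigenvalues i < 0) c)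
    simp only [LinearMap.coe_comp, Function.comp_apply, Matrix.mulVecLin_apply]
    rw [add_mulVec, dotProduct_add, Complex.add_re] at h1
    linarith

/-- A real shift `A + ε` of a Hermitian matrix avoiding the finitely many `−λ_i(A)` is invertible:
`det (A + ε) = (−1)^n · charpoly_A(−ε) = (−1)^n ∏ (−ε − λ_i) ≠ 0`. -/
theorem inertia_det_add_smul_one_ne_zero {A : Matrix n n ℂ} (hA : A.IsHermitian) {ε : ℝ}
    (hε : ∀ i, hA.eigenvalues i ≠ -ε) :
    (A + ((ε : ℝ) : ℂ) • (1 : Matrix n n ℂ)).det ≠ 0 := by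
  intro h0
  have h1 : A.charpoly.eval (-((ε : ℝ) : ℂ)) = 0 := by
    rw [eval_charpoly, scalar_apply, ← smul_one_eq_diagonal]
    have : (-((ε : ℝ) : ℂ)) • (1 : Matrix n n ℂ) - A =
        -(A + ((ε : ℝ) : ℂ) • (1 : Matrix n n ℂ)) := by
      rw [neg_smul, neg_add, sub_eq_neg_add]
    rw [this, det_neg, h0, mul_zero]
  have h2 : (-((ε : ℝ) : ℂ)) ∈ A.charpoly.roots :=
    (Polynomial.mem_roots (charpoly_monic A).ne_zero).2 (Polynomial.IsRoot.def.2 h1)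
  rw [hA.roots_charpoly_eq_eigenvalues, Multiset.mem_map] at h2
  obtain ⟨i, _, hi⟩ := h2
  have hi' : ((hA.eigenvalues i : ℝ) : ℂ) = ((-ε : ℝ) : ℂ) := by
    rw [Complex.ofReal_neg]
    exact hi
  exact hε i (Complex.ofReal_injective hi')

end Weyl

section OffBlockWeak

/-- **Off-block monotonicity of the inertia, one-sided invertibility.**  Let `H, H'` be Hermitian
on `ι`, `P` a decidable predicate ("inside") and `K` a finite set of indices such that: `H` and `H'`
agree outside (`¬P × ¬P`), the inside/outside couplings of both vanish off the columns in `K`, and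
the inside block `A = H|_{P×P}` of `H` is invertible.  Then, with `A' = H'|_{P×P}` (NOT assumed
invertible), `n₋(H) + n₋(A') ≤ n₋(H') + n₋(A) + #K`.  Proof: ε-regularisation `H'_ε = H' + ε Π_P`
(`0 < ε` small, off the finitely many `−λ_i(A')`): `A'_ε = A' + ε` is invertible,
`n₋(A') ≤ n₋(A'_ε)` (`negRootCount_local`), `n₋(H'_ε) ≤ n₋(H')` (Weyl), and
`inertia_offBlock_monotone` for `H, H'_ε`. -/
theorem inertia_offBlock_monotone_weak :
    ∀ {ι : Type*} [Fintype ι] [DecidableEq ι] (P : ι → Prop) [DecidablePred P] (K : Finset ι)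
      {H H' : Matrix ι ι ℂ}, H.IsHermitian → H'.IsHermitian →
      (∀ i j, ¬ P i → ¬ P j → H' i j = H i j) →
      (∀ i j, P i → ¬ P j → j ∉ K → H i j = 0) →
      (∀ i j, P i → ¬ P j → j ∉ K → H' i j = 0) →
      (H.submatrix (Subtype.val : {i // P i} → ι) Subtype.val).det ≠ 0 →
      negRootCount H + negRootCount (H'.submatrix (Subtype.val : {i // P i} → ι) Subtype.val) ≤
        negRootCount H' + negRootCount (H.submatrix (Subtype.val : {i // P i} → ι) Subtype.val) +
          K.card := by
  intro ι _ _ P _ K H H' hH hH' hS hB hB' hA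
  set A' : Matrix {i // P i} {i // P i} ℂ :=
    H'.submatrix (Subtype.val : {i // P i} → ι) Subtype.val with hA'def
  have hA'h : A'.IsHermitian := hH'.submatrix _
  -- local lower semicontinuity of `n₋` along the pencil `A' + t`
  have hΓv : ∀ v : {i // P i} → ℂ,
      |(star v ⬝ᵥ ((1 : Matrix {i // P i} {i // P i} ℂ) *ᵥ v)).re| ≤ ∑ i, ‖v i‖ ^ 2 := by
    intro v
    rw [one_mulVec, re_star_dotProduct_self]
    exact le_of_eq (abs_of_nonneg (Finset.sum_nonneg fun i _ => by positivity))
  obtain ⟨r, hr, hrle⟩ := negRootCount_local hA'h isHermitian_one hΓv 0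
  -- a small `ε > 0` off the finitely many `-λ_i(A')`
  obtain ⟨ε, hεI, hεF⟩ := (Set.Ioo_infinite hr).exists_notMem_finset
    (Finset.univ.image fun i => -hA'h.eigenvalues i)
  rw [Set.mem_Ioo] at hεI
  obtain ⟨hε0, hεr⟩ := hεI
  have hεne : ∀ i, hA'h.eigenvalues i ≠ -ε := fun i hi =>
    hεF (Finset.mem_image.2 ⟨i, Finset.mem_univ _, by rw [hi, neg_neg]⟩)
  -- the regularisation `H' + ε Π_P`
  set D : Matrix ι ι ℂ := diagonal fun i => if P i then ((ε : ℝ) : ℂ) else 0 with hDdef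
  have hD : D.IsHermitian := by
    rw [hDdef, isHermitian_diagonal_iff]
    intro i
    rw [isSelfAdjoint_iff]
    split_ifs
    · rw [Complex.star_def, Complex.conj_ofReal]
    · exact star_zero _
  have hH'D : (H' + D).IsHermitian := hH'.add hD
  have hDform : ∀ v : ι → ℂ, 0 ≤ (star v ⬝ᵥ (D *ᵥ v)).re := by
    intro v
    rw [dotProduct, Complex.re_sum]
    refine Finset.sum_nonneg fun i _ => ?_
    rw [hDdef, mulVec_diagonal, Pi.star_apply, Complex.star_def]
    split_ifs
    · have : (starRingEnd ℂ) (v i) * (((ε : ℝ) : ℂ) * v i) =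
          ((ε : ℝ) : ℂ) * ((starRingEnd ℂ) (v i) * v i) := by ring
      rw [this, ← Complex.normSq_eq_conj_mul_self, Complex.re_ofReal_mul, Complex.ofReal_re]
      exact mul_nonneg hε0.le (Complex.normSq_nonneg _)
    · rw [zero_mul, mul_zero, Complex.zero_re]
  -- its blocks
  have hSD : ∀ i j, ¬ P i → ¬ P j → (H' + D) i j = H i j := by
    intro i j hi hj
    rw [Matrix.add_apply, hS i j hi hj, hDdef, diagonal_apply]
    split_ifs <;> simp
  have hBD : ∀ i j, P i → ¬ P j → j ∉ K → (H' + D) i j = 0 := by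
    intro i j hi hj hjK
    have hij : i ≠ j := by
      rintro rfl
      exact hj hi
    rw [Matrix.add_apply, hB' i j hi hj hjK, hDdef, diagonal_apply_ne _ hij, add_zero]
  have hblock : (H' + D).submatrix (Subtype.val : {i // P i} → ι) Subtype.val =
      A' + ((ε : ℝ) : ℂ) • (1 : Matrix {i // P i} {i // P i} ℂ) := by
    ext i j
    rw [submatrix_apply, Matrix.add_apply, Matrix.add_apply, hA'def, submatrix_apply,
      Matrix.smul_apply, hDdef, diagonal_apply, one_apply, smul_eq_mul, mul_ite, mul_one, mul_zero]
    by_cases hij : i = j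
    · subst hij
      rw [if_pos rfl, if_pos rfl, if_pos i.2]
    · rw [if_neg (fun h => hij (Subtype.ext h)), if_neg hij]
  have hdetD : ((H' + D).submatrix (Subtype.val : {i // P i} → ι) Subtype.val).det ≠ 0 := by
    rw [hblock]
    exact inertia_det_add_smul_one_ne_zero hA'h hεne
  -- (b) `n₋(A') ≤ n₋(A' + ε)`
  have hb : negRootCount A' ≤
      negRootCount (A' + ((ε : ℝ) : ℂ) • (1 : Matrix {i // P i} {i // P i} ℂ)) := by
    have h := (hrle ε (by rwa [sub_zero, abs_of_pos hε0])).1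
    rwa [Complex.ofReal_zero, zero_smul, add_zero] at h
  -- (c) `n₋(H' + ε Π) ≤ n₋(H')`
  have hc : negRootCount (H' + D) ≤ negRootCount H' :=
    inertia_negRootCount_add_le_of_form_nonneg hH' hD hDform
  -- Haynsworth + rank slack for `H, H' + ε Π`
  have h1 := inertia_offBlock_monotone P K hH hH'D hSD hB hBD hA hdetD
  rw [hblock] at h1
  omega

end OffBlockWeak

/-! ## The stub -/

section Stub

open Literature.MathematicalPhysics.QuantumLattice Literature.MathematicalPhysics.QuantumFieldTheory
  Literature.Probability.LatticeModels
open scoped Classical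

/-- **STUB S7′ `stub_inertiaMonotoneWeak` (strict monotonicity of the deep index under a box
surgery, one-sided invertibility).**  Let `U, U'` be two `SU(3)` gauge fields on the four-torus of
side `n > 2R+1` that agree on every link based outside the image of the box `c + {−R, …, R}⁴`, and
let `A, A'` be the principal blocks of `H = Γ₅ D_W(U, −δ, 1)`, `H' = Γ₅ D_W(U', −δ, 1)` over the
quark indices of that image.  If `A` is invertible and `n₋(A') ≥ n₋(A) + 96 (2R+1)³ + 1`, then
`n₋(H') ≥ n₋(H) + 1` (negative roots of the characteristic polynomial, with multiplicity) — NO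
invertibility of `A'` is needed.  Proof: `inertia_offBlock_monotone_weak` (Haynsworth inertia
additivity + rank slack after an ε-regularisation of the `U'`-side inside block) for the
inside/outside splitting — the outside blocks of `H, H'` agree and the couplings are supported on
the `≤ 96 (2R+1)³` columns over the outside sites adjacent to the image (as in S7). -/
theorem stub_inertiaMonotoneWeak :
    ∀ (n : ℕ) [NeZero n] (R : ℕ), 2 * R + 1 < n → ∀ (c : Fin 4 → ℤ) (δ : ℝ) (U U' : GaugeConfig 4 n SU3),
      (∀ e, (¬ ∃ y : ↥(box 4 R), Torus.proj n (c + (y : Fin 4 → ℤ)) = e.1) → U' e = U e) →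
      ((spinorLift gammaFive * wilsonDirac (fundamentalRep (Fin 3)) U (-δ) 1).submatrix
          (Subtype.val : {p : TorusSite 4 n × Fin 3 × Fin 4 //
            ∃ y : ↥(box 4 R), Torus.proj n (c + (y : Fin 4 → ℤ)) = p.1} → _) Subtype.val).det ≠ 0 →
      negRootCount ((spinorLift gammaFive * wilsonDirac (fundamentalRep (Fin 3)) U (-δ) 1).submatrix
          (Subtype.val : {p : TorusSite 4 n × Fin 3 × Fin 4 //
            ∃ y : ↥(box 4 R), Torus.proj n (c + (y : Fin 4 → ℤ)) = p.1} → _) Subtype.val) +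
          96 * (2 * R + 1) ^ 3 + 1 ≤
        negRootCount ((spinorLift gammaFive * wilsonDirac (fundamentalRep (Fin 3)) U' (-δ) 1).submatrix
          (Subtype.val : {p : TorusSite 4 n × Fin 3 × Fin 4 //
            ∃ y : ↥(box 4 R), Torus.proj n (c + (y : Fin 4 → ℤ)) = p.1} → _) Subtype.val) →
      (spinorLift gammaFive * wilsonDirac (fundamentalRep (Fin 3)) U (-δ) 1).charpoly.roots.countP
            (fun z : ℂ => z.re < 0) + 1 ≤
        (spinorLift gammaFive * wilsonDirac (fundamentalRep (Fin 3)) U' (-δ) 1).charpoly.roots.countP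
            (fun z : ℂ => z.re < 0) := by
  intro n _ R _ c δ U U' hUU' hA hgap
  set H : Matrix (TorusSite 4 n × Fin 3 × Fin 4) (TorusSite 4 n × Fin 3 × Fin 4) ℂ :=
    spinorLift gammaFive * wilsonDirac (fundamentalRep (Fin 3)) U (-δ) 1
  set H' : Matrix (TorusSite 4 n × Fin 3 × Fin 4) (TorusSite 4 n × Fin 3 × Fin 4) ℂ :=
    spinorLift gammaFive * wilsonDirac (fundamentalRep (Fin 3)) U' (-δ) 1
  -- the boundary columns: indices over the outside sites adjacent to the image of the box
  obtain ⟨T, hTcard, hT⟩ := inertia_exists_adjSites n R c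
  set K : Finset (TorusSite 4 n × Fin 3 × Fin 4) := T ×ˢ Finset.univ with hKdef
  have hK : K.card ≤ 96 * (2 * R + 1) ^ 3 := by
    have h2 : K.card = T.card * 12 := by
      rw [hKdef, Finset.card_product, Finset.card_univ, Fintype.card_prod, Fintype.card_fin,
        Fintype.card_fin]
    rw [h2]
    calc T.card * 12 ≤ 8 * (2 * R + 1) ^ 3 * 12 := Nat.mul_le_mul_right _ hTcard
      _ = 96 * (2 * R + 1) ^ 3 := by ring
  -- Hermiticity of `Γ₅ D_W` (γ₅-hermiticity, unitary colour representation)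
  have hH : H.IsHermitian :=
    Literature.Barriers.QuantumFields.WilsonDeterminant.isHermitian_hermitianWilsonDirac _
      fundamentalRep_mem_unitaryGroup U (-δ) 1
  have hH' : H'.IsHermitian :=
    Literature.Barriers.QuantumFields.WilsonDeterminant.isHermitian_hermitianWilsonDirac _
      fundamentalRep_mem_unitaryGroup U' (-δ) 1
  -- the outside blocks agree: an outside/outside entry only reads links based outside
  have hS : ∀ p q : TorusSite 4 n × Fin 3 × Fin 4,
      ¬ (∃ y : ↥(box 4 R), Torus.proj n (c + (y : Fin 4 → ℤ)) = p.1) →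
      ¬ (∃ y : ↥(box 4 R), Torus.proj n (c + (y : Fin 4 → ℤ)) = q.1) → H' p q = H p q :=
    fun p q hp hq => inertia_hermitianWilson_congr (fundamentalRep (Fin 3)) (-δ) 1
      (fun μ => hUU' (p.1, μ) hp) (fun μ => hUU' (q.1, μ) hq)
  -- the inside/outside couplings are supported on the boundary columns (range one)
  have hB : ∀ (V : GaugeConfig 4 n SU3) (p q : TorusSite 4 n × Fin 3 × Fin 4),
      (∃ y : ↥(box 4 R), Torus.proj n (c + (y : Fin 4 → ℤ)) = p.1) →
      ¬ (∃ y : ↥(box 4 R), Torus.proj n (c + (y : Fin 4 → ℤ)) = q.1) → q ∉ K →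
        (spinorLift (L := n) (N := 3) gammaFive * wilsonDirac (fundamentalRep (Fin 3)) V (-δ) 1) p q
          = 0 := by
    intro V p q hp hq hqK
    have hqK' : q.1 ∉ T := fun h =>
      hqK (by rw [hKdef, Finset.mem_product]; exact ⟨h, Finset.mem_univ _⟩)
    have hpq : p ≠ q := by
      rintro rfl
      exact hq hp
    exact inertia_hermitianWilson_eq_zero (fundamentalRep (Fin 3)) V (-δ) 1 hpq
      (fun μ h => hqK' (inertia_adj_mem hT hp hq μ (Or.inl h)))
      (fun μ h => hqK' (inertia_adj_mem hT hp hq μ (Or.inr h)))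
  -- Haynsworth inertia additivity + rank slack, one-sided invertibility
  have h := inertia_offBlock_monotone_weak
    (fun p : TorusSite 4 n × Fin 3 × Fin 4 =>
      ∃ y : ↥(box 4 R), Torus.proj n (c + (y : Fin 4 → ℤ)) = p.1)
    K hH hH' hS (hB U) (hB U') hA
  change negRootCount H + 1 ≤ negRootCount H'
  generalize 96 * (2 * R + 1) ^ 3 = t at hK hgap
  omega

end Stub

end Summit.QuantumFields.QCD.Cruxes.WindowExtinction.FreeVolumeHeavyWitness

end
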